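import Summits.QuantumFields.YangMills.Theorems.BalabanLadderIRHeavyTwistWallSectorCS
import HarnessLib

/-!
# Sector Cauchy–Schwarz for cyclic kernel chains: the path-space (time-sliced) form (heavy-twist wall, reading B)

HELPER 2/6 for the crux `BalabanLadder.IR` (stmt-QuantumFields-19354), line `heavy-twist` RUNG 2 on even boxes (wall seat
`ym-ir-wall-p1`).  Companion of `BalabanLadderIRHeavyTwistWallSectorCS` (the abstract two-variable inequality
`sector_cauchySchwarz`).  Here the two-variable function is the ITERATED transfer kernel of a cyclic chain of `2h` time slices
(`h = n + 1`), and the four numbers `Z, Zᵀ, X, W` are identified with cyclic path integrals — the shapes delivered by the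
time-slicing theorems of `Literature.MathematicalPhysics.QuantumFieldTheory.WilsonFinTorusSliceChain` /
`WilsonFinTorusTwistedPartition` (lit-4, p611125) — via the tree's peeling identities
`Literature.Analysis.OperatorTheory.integral_cyclic_eq_integral_iterate` (two one-site insertions) and
`integral_cyclic_insert_one` (one bond insertion = the twisted bond).  Everything PROVED, no definitions (the pointwise
operator `(κ g)(w) = ∫ K(w,z) g(z) dρ(z)` and the iterated kernel `K⁽ⁿ⁺¹⁾(x,y) = (κ^[n] K(·,y))(x)` are written out):

* `iterKernel_measurable_bdd`, `iterKernel_apply` (`(κ^[n+1] g)(x) = ∫ K⁽ⁿ⁺¹⁾(x,y) g(y)`), `iterKernel_symm`;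
* `twoSite_chain_eq` — `∫ F(V 0) G(V h) ∏ₜ K(V t, V (t+1)) dρ^{⊗2h} = ∫∫ F(x) G(y) K⁽ʰ⁾(x,y) K⁽ʰ⁾(y,x)`;
* `twistedBond_chain_eq` — `∫ K(T V₀, V₁) ∏_{t ≥ 1} K(V t, V (t+1)) dρ^{⊗2h} = ∫∫ K⁽ʰ⁾(Tx, y) K⁽ʰ⁾(y, x)`;
* `sector_bound_chain` (**main**) — for a symmetric bounded measurable kernel `K`, a measurable measure-preserving involution
  `T` and a bounded measurable `T`-odd one-slice observable `f` (`|f| ≤ B`): with `Z = ∫ ∏ K`, `Zᵀ` the chain with the bond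
  leaving slice `0` twisted, `X = ∫ f(V 0) f(V h) ∏ K`, `W = ∫ f(V 0)² ∏ K`:  `X² ≤ 2B² W (Z − Zᵀ)` and `X² ≤ 2B² W (Z + Zᵀ)`.

HONEST FRAMING: inequalities between finite cyclic kernel integrals; nothing here proves `BalabanLadder.IR`, its seed `E`, or the
Yang–Mills mass gap (Clay); R4 closes only `BalabanLadder.UV`.  Mechanism: Borgs–Seiler 1983 Lemma II.6–II.8 / 't Hooft 1979 §5
(sectors of the centre flip); credit idea-2 O10 (sector Cauchy–Schwarz).
-/

set_option autoImplicit false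

noncomputable section

open MeasureTheory Filter Set Function
open Literature.Analysis.OperatorTheory

namespace Summit.QuantumFields.YangMills.Cruxes.IR.HeavyTwistWall

section IterKernel

variable {Y : Type*} [MeasurableSpace Y] {ρ : Measure Y} [IsFiniteMeasure ρ] {K : Y → Y → ℝ} {C : ℝ}

/-- **The iterated kernel `K⁽ⁿ⁺¹⁾(x, y) = (κ^[n] K(·, y))(x)` is jointly measurable and bounded** by `C (C ρ(Y))ⁿ`. -/
theorem iterKernel_measurable_bdd (hK : Measurable (uncurry K)) (hC : ∀ x y, ‖K x y‖ ≤ C) (n : ℕ) :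
    Measurable (uncurry fun x y => ((fun g : Y → ℝ => fun w => ∫ z, K w z * g z ∂ρ)^[n] (fun z => K z y)) x) ∧
      ∀ x y, ‖((fun g : Y → ℝ => fun w => ∫ z, K w z * g z ∂ρ)^[n] (fun z => K z y)) x‖ ≤ C * (C * ρ.real univ) ^ n := by
  induction n with
  | zero =>
    refine ⟨?_, fun x y => ?_⟩
    · simpa [Function.iterate_zero] using hK
    · simpa using hC x y
  | succ n ih =>
    obtain ⟨ihm, ihb⟩ := ih
    set G : Y → Y → ℝ := fun z y => ((fun g : Y → ℝ => fun w => ∫ z, K w z * g z ∂ρ)^[n] (fun z => K z y)) z with hG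
    have hGm : Measurable (uncurry G) := ihm
    have hfun : (uncurry fun x y => ((fun g : Y → ℝ => fun w => ∫ z, K w z * g z ∂ρ)^[n + 1] (fun z => K z y)) x) =
        fun q : Y × Y => ∫ z, K q.1 z * G z q.2 ∂ρ := by
      funext q
      simp only [uncurry, Function.iterate_succ_apply', hG]
    refine ⟨?_, fun x y => ?_⟩
    · rw [hfun]
      have hH : Measurable fun r : (Y × Y) × Y => K r.1.1 r.2 * G r.2 r.1.2 :=
        (hK.comp ((measurable_fst.comp measurable_fst).prodMk measurable_snd)).mul
          (hGm.comp (measurable_snd.prodMk (measurable_snd.comp measurable_fst)))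
      exact (hH.stronglyMeasurable.integral_prod_right' (ν := ρ)).measurable
    · have e : ((fun g : Y → ℝ => fun w => ∫ z, K w z * g z ∂ρ)^[n + 1] (fun z => K z y)) x = ∫ z, K x z * G z y ∂ρ := by
        simp only [Function.iterate_succ_apply', hG]
      rw [e]
      have hb : ∀ z, ‖K x z * G z y‖ ≤ C * (C * (C * ρ.real univ) ^ n) := fun z => by
        rw [norm_mul]
        exact mul_le_mul (hC x z) (ihb z y) (norm_nonneg _) ((norm_nonneg _).trans (hC x z))
      calc ‖∫ z, K x z * G z y ∂ρ‖ ≤ C * (C * (C * ρ.real univ) ^ n) * ρ.real univ :=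
            norm_integral_le_of_norm_le_const (Eventually.of_forall hb)
        _ = C * (C * ρ.real univ) ^ (n + 1) := by ring

/-- **Operator iterates are integrals against the iterated kernel**: `(κ^[n+1] g)(x) = ∫ K⁽ⁿ⁺¹⁾(x, y) g(y) dρ(y)` for bounded
measurable `g` (associativity of the kernel operators, `integral_kernel_mul_integral_kernel_mul`). -/
theorem iterKernel_apply (hK : Measurable (uncurry K)) (hC : ∀ x y, ‖K x y‖ ≤ C) (n : ℕ) {g : Y → ℝ} (hg : Measurable g)
    {B : ℝ} (hgb : ∀ y, ‖g y‖ ≤ B) (x : Y) :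
    ((fun g : Y → ℝ => fun w => ∫ z, K w z * g z ∂ρ)^[n + 1] g) x =
      ∫ y, ((fun g : Y → ℝ => fun w => ∫ z, K w z * g z ∂ρ)^[n] (fun z => K z y)) x * g y ∂ρ := by
  induction n generalizing x with
  | zero => simp
  | succ n ih =>
    obtain ⟨hm, hb⟩ := iterKernel_measurable_bdd (ρ := ρ) hK hC n
    rw [Function.iterate_succ_apply']
    have e1 : ∫ z, K x z * ((fun g : Y → ℝ => fun w => ∫ z, K w z * g z ∂ρ)^[n + 1] g) z ∂ρ =
        ∫ z, K x z * ∫ y, ((fun g : Y → ℝ => fun w => ∫ z, K w z * g z ∂ρ)^[n] (fun z' => K z' y)) z * g y ∂ρ ∂ρ := by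
      refine integral_congr_ae (Eventually.of_forall fun z => ?_)
      dsimp only
      rw [ih z]
    rw [e1, integral_kernel_mul_integral_kernel_mul (ρ := ρ) hK
      (K₁ := fun z y => ((fun g : Y → ℝ => fun w => ∫ z, K w z * g z ∂ρ)^[n] (fun z' => K z' y)) z) hm hC hb hg hgb x]
    refine integral_congr_ae (Eventually.of_forall fun y => ?_)
    dsimp only
    rw [Function.iterate_succ_apply']

/-- **The iterated kernel of a symmetric kernel is symmetric.** -/
theorem iterKernel_symm (hK : Measurable (uncurry K)) (hC : ∀ x y, ‖K x y‖ ≤ C) (hsymm : ∀ x y, K x y = K y x) (n : ℕ) :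
    ∀ x y, ((fun g : Y → ℝ => fun w => ∫ z, K w z * g z ∂ρ)^[n] (fun z => K z y)) x =
      ((fun g : Y → ℝ => fun w => ∫ z, K w z * g z ∂ρ)^[n] (fun z => K z x)) y := by
  induction n with
  | zero => intro x y; simpa using hsymm x y
  | succ n ih =>
    intro x y
    have hKy : Measurable fun z => K z y := hK.comp (measurable_id.prodMk measurable_const)
    -- `K⁽ⁿ⁺²⁾(y, x) = ∫ K(y,z) K⁽ⁿ⁺¹⁾(z,x) = ∫ K⁽ⁿ⁺¹⁾(x,z) K(z,y) = (κ^[n+1] K(·,y))(x) = K⁽ⁿ⁺²⁾(x,y)`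
    rw [iterKernel_apply (ρ := ρ) hK hC n hKy (fun z => hC z y) x]
    conv_rhs => rw [Function.iterate_succ_apply']
    refine integral_congr_ae (Eventually.of_forall fun z => ?_)
    dsimp only
    rw [hsymm y z, ih x z, mul_comm]

end IterKernel

/-! ## The cyclic chains as two-variable integrals of the iterated kernel -/

section Chains

variable {Y : Type*} [MeasurableSpace Y] {ρ : Measure Y} [IsFiniteMeasure ρ] {K : Y → Y → ℝ} {C : ℝ}

/-- **Two one-site insertions at antipodal slices of an even cycle.**  On the cycle of `2h = (n+1) + (n+1)` slices,
`∫ F(V 0) G(V h) ∏ₜ K(V t, V (t+1)) dρ^{⊗2h} = ∫∫ F(x) G(y) K⁽ʰ⁾(x, y) K⁽ʰ⁾(y, x) dρ(y) dρ(x)` (`h = n + 1`; the two arcs between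
the insertions become the iterated kernels; `integral_cyclic_eq_integral_iterate` + `iterKernel_apply`). -/
theorem twoSite_chain_eq (hK : Measurable (uncurry K)) (hC : ∀ x y, ‖K x y‖ ≤ C) (n : ℕ) {F G : Y → ℝ}
    (hF : Measurable F) (hG : Measurable G) {BF BG : ℝ} (hFb : ∀ y, ‖F y‖ ≤ BF) (hGb : ∀ y, ‖G y‖ ≤ BG)
    (p : Fin (n + 1 + n + 1)) (hp : (p : ℕ) = n + 1) :
    ∫ V : Fin (n + 1 + n + 1) → Y, F (V 0) * G (V p) * ∏ t, K (V t) (V (t + 1)) ∂(Measure.pi fun _ => ρ) =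
      ∫ x, ∫ y, F x * G y *
        (((fun g : Y → ℝ => fun w => ∫ z, K w z * g z ∂ρ)^[n] (fun z => K z y)) x *
          ((fun g : Y → ℝ => fun w => ∫ z, K w z * g z ∂ρ)^[n] (fun z => K z x)) y) ∂ρ ∂ρ := by
  obtain ⟨hm, hb⟩ := iterKernel_measurable_bdd (ρ := ρ) hK hC n
  rw [integral_cyclic_eq_integral_iterate (ρ := ρ) hK hC n n hF hG hFb hGb p hp]
  refine integral_congr_ae (Eventually.of_forall fun x => ?_)
  dsimp only
  -- the inner observable `y ↦ G(y) K⁽ʰ⁾(y, x)` is bounded and measurable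
  have hgm : Measurable fun y => G y * ((fun g : Y → ℝ => fun w => ∫ z, K w z * g z ∂ρ)^[n] (fun z => K z x)) y :=
    hG.mul (hm.comp (measurable_id.prodMk measurable_const))
  have hgb : ∀ y, ‖G y * ((fun g : Y → ℝ => fun w => ∫ z, K w z * g z ∂ρ)^[n] (fun z => K z x)) y‖ ≤
      BG * (C * (C * ρ.real univ) ^ n) := fun y => by
    rw [norm_mul]; exact mul_le_mul (hGb y) (hb y x) (norm_nonneg _) ((norm_nonneg _).trans (hGb y))
  rw [iterKernel_apply (ρ := ρ) hK hC n hgm hgb x, ← integral_const_mul]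
  refine integral_congr_ae (Eventually.of_forall fun y => ?_)
  dsimp only
  ring

/-- **One twisted bond.**  On the cycle of `2h = 1 + (n + n) + 1` slices whose bond leaving slice `0` carries the twisted kernel
`K(T V₀, V₁)` (`T` measurable):  `∫ K(T V₀, V₁) ∏_{t ≥ 1} K(V t, V (t+1)) dρ^{⊗2h} = ∫∫ K⁽ʰ⁾(T x, y) K⁽ʰ⁾(y, x) dρ(y) dρ(x)`
(`integral_cyclic_insert_one`, then split `K⁽²ʰ⁾ = K⁽ʰ⁾ ∗ K⁽ʰ⁾` by `iterKernel_apply`). -/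
theorem twistedBond_chain_eq (hK : Measurable (uncurry K)) (hC : ∀ x y, ‖K x y‖ ≤ C) {T : Y → Y} (hTm : Measurable T)
    (n : ℕ) :
    ∫ V : Fin (1 + (n + n) + 1) → Y, K (T (V 0)) (V 1) * ∏ t : Fin (1 + (n + n)), K (V t.succ) (V (t.succ + 1))
        ∂(Measure.pi fun _ => ρ) =
      ∫ x, ∫ y, ((fun g : Y → ℝ => fun w => ∫ z, K w z * g z ∂ρ)^[n] (fun z => K z y)) (T x) *
        ((fun g : Y → ℝ => fun w => ∫ z, K w z * g z ∂ρ)^[n] (fun z => K z x)) y ∂ρ ∂ρ := by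
  obtain ⟨hm, hb⟩ := iterKernel_measurable_bdd (ρ := ρ) hK hC n
  have hX : Measurable (uncurry fun x y => K (T x) y) := hK.comp ((hTm.comp measurable_fst).prodMk measurable_snd)
  rw [integral_cyclic_insert_one (ρ := ρ) hX hK (fun x y => hC (T x) y) hC (n + n)]
  refine integral_congr_ae (Eventually.of_forall fun x => ?_)
  dsimp only
  -- `∫ K(Tx, y) K⁽²ⁿ⁺¹⁾(y, x) dy = (κ^[(n+1)+n] K(·,x))(Tx) = (κ^[n+1] K⁽ⁿ⁺¹⁾(·, x))(Tx) = ∫ K⁽ⁿ⁺¹⁾(Tx, y) K⁽ⁿ⁺¹⁾(y, x) dy`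
  have hgm : Measurable fun y => ((fun g : Y → ℝ => fun w => ∫ z, K w z * g z ∂ρ)^[n] (fun z => K z x)) y :=
    hm.comp (measurable_id.prodMk measurable_const)
  have e1 : ∫ y, K (T x) y * ((fun g : Y → ℝ => fun w => ∫ z, K w z * g z ∂ρ)^[n + n] (fun z => K z x)) y ∂ρ =
      ((fun g : Y → ℝ => fun w => ∫ z, K w z * g z ∂ρ)^[n + n + 1] (fun z => K z x)) (T x) := by
    rw [Function.iterate_succ_apply']
  rw [e1, show n + n + 1 = (n + 1) + n by ring, Function.iterate_add_apply,
    iterKernel_apply (ρ := ρ) hK hC n hgm (fun y => hb y x) (T x)]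

end Chains

/-! ## Main: the sector bound for the four cyclic chains -/

section Main

variable {Y : Type*} [MeasurableSpace Y] {ρ : Measure Y} [IsFiniteMeasure ρ] {K : Y → Y → ℝ} {C B : ℝ} {T : Y → Y}
  {f : Y → ℝ}

/-- **Sector Cauchy–Schwarz for cyclic kernel chains (path-space form).**  `K` a symmetric bounded measurable kernel on a finite
measure space, `T` a measurable measure-preserving involution, `f` a bounded measurable `T`-odd one-slice observable (`|f| ≤ B`).
On the even cycle of `2h` slices (`h = n + 1`; written `(n+1)+(n+1)` for the chains with site insertions and `1+(n+n)+1` for the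
chain with the twisted bond, the shapes of the time-slicing theorems): with
`Z = ∫ ∏ₜ K(V t, V (t+1))`, `Zᵀ = ∫ K(T V₀, V₁) ∏_{t≥1} K(V t, V (t+1))`, `X = ∫ f(V 0) f(V h) ∏ₜ K`, `W = ∫ f(V 0)² ∏ₜ K`,
**`X² ≤ 2 B² W (Z − Zᵀ)` and `X² ≤ 2 B² W (Z + Zᵀ)`**.  (No invariance of `K` under `T` is needed.)
[mechanism: Borgs–Seiler 1983 Lemma II.6–II.8; 't Hooft 1979 §5; idea-2 O10] -/
theorem sector_bound_chain (hK : Measurable (uncurry K)) (hC : ∀ x y, ‖K x y‖ ≤ C) (hsymm : ∀ x y, K x y = K y x)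
    (hTm : Measurable T) (hT : MeasurePreserving T ρ ρ) (hTT : ∀ x, T (T x) = x)
    (hf : Measurable f) (hfb : ∀ x, ‖f x‖ ≤ B) (hfT : ∀ x, f (T x) = -f x)
    (n : ℕ) (p : Fin (n + 1 + n + 1)) (hp : (p : ℕ) = n + 1) :
    (∫ V : Fin (n + 1 + n + 1) → Y, f (V 0) * f (V p) * ∏ t, K (V t) (V (t + 1)) ∂(Measure.pi fun _ => ρ)) ^ 2 ≤
        2 * B ^ 2 * (∫ V : Fin (n + 1 + n + 1) → Y, f (V 0) ^ 2 * ∏ t, K (V t) (V (t + 1)) ∂(Measure.pi fun _ => ρ)) *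
          ((∫ V : Fin (n + 1 + n + 1) → Y, ∏ t, K (V t) (V (t + 1)) ∂(Measure.pi fun _ => ρ)) -
            ∫ V : Fin (1 + (n + n) + 1) → Y, K (T (V 0)) (V 1) * ∏ t : Fin (1 + (n + n)), K (V t.succ) (V (t.succ + 1))
              ∂(Measure.pi fun _ => ρ)) ∧
      (∫ V : Fin (n + 1 + n + 1) → Y, f (V 0) * f (V p) * ∏ t, K (V t) (V (t + 1)) ∂(Measure.pi fun _ => ρ)) ^ 2 ≤
        2 * B ^ 2 * (∫ V : Fin (n + 1 + n + 1) → Y, f (V 0) ^ 2 * ∏ t, K (V t) (V (t + 1)) ∂(Measure.pi fun _ => ρ)) *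
          ((∫ V : Fin (n + 1 + n + 1) → Y, ∏ t, K (V t) (V (t + 1)) ∂(Measure.pi fun _ => ρ)) +
            ∫ V : Fin (1 + (n + n) + 1) → Y, K (T (V 0)) (V 1) * ∏ t : Fin (1 + (n + n)), K (V t.succ) (V (t.succ + 1))
              ∂(Measure.pi fun _ => ρ)) := by
  obtain ⟨hm, hb⟩ := iterKernel_measurable_bdd (ρ := ρ) hK hC n
  set Kn : Y → Y → ℝ := fun x y => ((fun g : Y → ℝ => fun w => ∫ z, K w z * g z ∂ρ)^[n] (fun z => K z y)) x with hKn
  have fold : ∀ x y, ((fun g : Y → ℝ => fun w => ∫ z, K w z * g z ∂ρ)^[n] (fun z => K z y)) x = Kn x y := fun x y => rfl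
  have hKn_symm : ∀ x y, Kn y x = Kn x y := fun x y => (iterKernel_symm (ρ := ρ) hK hC hsymm n x y).symm
  have hB0 : ∀ x, |f x| ≤ B := fun x => by simpa [Real.norm_eq_abs] using hfb x
  have h1m : Measurable fun _ : Y => (1 : ℝ) := measurable_const
  have h1b : ∀ y : Y, ‖(fun _ : Y => (1 : ℝ)) y‖ ≤ 1 := fun y => by simp
  have hf2m : Measurable fun x => f x ^ 2 := hf.pow_const 2
  have hf2b : ∀ x, ‖f x ^ 2‖ ≤ B ^ 2 := fun x => by rw [norm_pow]; exact pow_le_pow_left₀ (norm_nonneg _) (hfb x) 2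
  -- integrability on the product space of the two-variable integrands
  have mKn : Measurable fun q : Y × Y => Kn q.1 q.2 := hm
  have mKnT : Measurable fun q : Y × Y => Kn (T q.1) q.2 := hm.comp ((hTm.comp measurable_fst).prodMk measurable_snd)
  have bKn : ∀ q : Y × Y, ‖Kn q.1 q.2‖ ≤ C * (C * ρ.real univ) ^ n := fun q => hb q.1 q.2
  have iZ : Integrable (fun q : Y × Y => Kn q.1 q.2 ^ 2) (ρ.prod ρ) :=
    integrable_of_bdd _ (mKn.pow_const 2) (A := (C * (C * ρ.real univ) ^ n) ^ 2) fun q => by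
      rw [norm_pow]; exact pow_le_pow_left₀ (norm_nonneg _) (bKn q) 2
  have iT : Integrable (fun q : Y × Y => Kn (T q.1) q.2 * Kn q.1 q.2) (ρ.prod ρ) :=
    integrable_of_bdd _ (mKnT.mul mKn) (A := (C * (C * ρ.real univ) ^ n) * (C * (C * ρ.real univ) ^ n)) fun q => by
      rw [norm_mul]
      exact mul_le_mul (hb (T q.1) q.2) (bKn q) (norm_nonneg _) ((norm_nonneg _).trans (hb (T q.1) q.2))
  have iX : Integrable (fun q : Y × Y => f q.1 * f q.2 * Kn q.1 q.2 ^ 2) (ρ.prod ρ) :=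
    integrable_of_bdd _ (((hf.comp measurable_fst).mul (hf.comp measurable_snd)).mul (mKn.pow_const 2))
      (A := B * B * (C * (C * ρ.real univ) ^ n) ^ 2) fun q => by
      rw [norm_mul, norm_mul, norm_pow]
      exact mul_le_mul (mul_le_mul (hfb _) (hfb _) (norm_nonneg _) ((norm_nonneg _).trans (hfb q.1)))
        (pow_le_pow_left₀ (norm_nonneg _) (bKn q) 2) (by positivity)
        (mul_nonneg ((norm_nonneg _).trans (hfb q.1)) ((norm_nonneg _).trans (hfb q.1)))
  have iW : Integrable (fun q : Y × Y => f q.1 ^ 2 * Kn q.1 q.2 ^ 2) (ρ.prod ρ) :=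
    integrable_of_bdd _ ((hf2m.comp measurable_fst).mul (mKn.pow_const 2))
      (A := B ^ 2 * (C * (C * ρ.real univ) ^ n) ^ 2) fun q => by
      rw [norm_mul, norm_pow, norm_pow]
      exact mul_le_mul (pow_le_pow_left₀ (norm_nonneg _) (hfb q.1) 2) (pow_le_pow_left₀ (norm_nonneg _) (bKn q) 2)
        (by positivity) (by positivity)
  -- the four chains as product-space integrals
  have hZ : ∫ V : Fin (n + 1 + n + 1) → Y, ∏ t, K (V t) (V (t + 1)) ∂(Measure.pi fun _ => ρ) =
      ∫ q, Kn q.1 q.2 ^ 2 ∂(ρ.prod ρ) := by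
    have e : (fun V : Fin (n + 1 + n + 1) → Y => ∏ t, K (V t) (V (t + 1))) =
        fun V => (fun _ : Y => (1 : ℝ)) (V 0) * (fun _ : Y => (1 : ℝ)) (V p) * ∏ t, K (V t) (V (t + 1)) := by
      funext V; simp
    rw [e, twoSite_chain_eq (ρ := ρ) hK hC n h1m h1m h1b h1b p hp, integral_prod _ iZ]
    refine integral_congr_ae (Eventually.of_forall fun x => integral_congr_ae (Eventually.of_forall fun y => ?_))
    simp only [fold, hKn_symm x y, one_mul, sq]
  have hX : ∫ V : Fin (n + 1 + n + 1) → Y, f (V 0) * f (V p) * ∏ t, K (V t) (V (t + 1)) ∂(Measure.pi fun _ => ρ) =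
      ∫ q, f q.1 * f q.2 * Kn q.1 q.2 ^ 2 ∂(ρ.prod ρ) := by
    rw [twoSite_chain_eq (ρ := ρ) hK hC n hf hf hfb hfb p hp, integral_prod _ iX]
    refine integral_congr_ae (Eventually.of_forall fun x => integral_congr_ae (Eventually.of_forall fun y => ?_))
    simp only [fold, hKn_symm x y, sq]
  have hW : ∫ V : Fin (n + 1 + n + 1) → Y, f (V 0) ^ 2 * ∏ t, K (V t) (V (t + 1)) ∂(Measure.pi fun _ => ρ) =
      ∫ q, f q.1 ^ 2 * Kn q.1 q.2 ^ 2 ∂(ρ.prod ρ) := by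
    have e : (fun V : Fin (n + 1 + n + 1) → Y => f (V 0) ^ 2 * ∏ t, K (V t) (V (t + 1))) =
        fun V => (fun x => f x ^ 2) (V 0) * (fun _ : Y => (1 : ℝ)) (V p) * ∏ t, K (V t) (V (t + 1)) := by
      funext V; simp
    rw [e, twoSite_chain_eq (ρ := ρ) hK hC n hf2m h1m hf2b h1b p hp, integral_prod _ iW]
    refine integral_congr_ae (Eventually.of_forall fun x => integral_congr_ae (Eventually.of_forall fun y => ?_))
    simp only [fold, hKn_symm x y, mul_one, sq]
  have hT' : ∫ V : Fin (1 + (n + n) + 1) → Y, K (T (V 0)) (V 1) * ∏ t : Fin (1 + (n + n)), K (V t.succ) (V (t.succ + 1))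
        ∂(Measure.pi fun _ => ρ) = ∫ q, Kn (T q.1) q.2 * Kn q.1 q.2 ∂(ρ.prod ρ) := by
    rw [twistedBond_chain_eq (ρ := ρ) hK hC hTm n, integral_prod _ iT]
    refine integral_congr_ae (Eventually.of_forall fun x => integral_congr_ae (Eventually.of_forall fun y => ?_))
    simp only [fold, hKn_symm x y]
  rw [hZ, hX, hW, hT']
  exact sector_cauchySchwarz (ρ := ρ) (F := Kn) hTm hT hTT hm hb hf hfb hfT

end Main

end Summit.QuantumFields.YangMills.Cruxes.IR.HeavyTwistWall

end
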